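import Literature.Topology.FourManifolds.GroupTrisections
import Mathlib.GroupTheory.Index
import Mathlib.GroupTheory.QuotientGroup.Basic
import Mathlib.Algebra.Group.Conj
import HarnessLib

/-!
# Conjugacy separability of orientable surface groups (Stebe 1972) and their finite-index
# subgroups (Riemann–Hurwitz) — NAMED FACTS

Topic `Literature/GroupTheory/CombinatorialGroupTheory`.  Two classical results about the orientable
surface groups `S_g = ⟨a₁, b₁, …, a_g, b_g ∣ ∏ [aᵢ, bᵢ]⟩` (the tree's
`Literature.Topology.FourManifolds.SurfaceGroup g`), typed as NAMED FACTS (`def … : Prop`, D-0014: not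
proved here, never asserted), plus the formal consequence both are used through:

* `SurfaceGroupConjugacySeparable` — P. F. Stebe, *Conjugacy separability of certain Fuchsian groups*,
  Trans. Amer. Math. Soc. 163 (1972) 173–188, Theorem 3.3 (p. 182): the fundamental group of a closed
  orientable surface of genus `g ≥ 2` is conjugacy separable — non-conjugate elements have
  non-conjugate images in some finite quotient.  (A modern topological proof: H. Wilton, *Virtual
  retractions, conjugacy separability and omnipotence*, J. Algebra 323 (2010).)  This is the input
  "[Stb2], Theorem 3.3" of S. Mochizuki, IUTchI, proof of Theorem 2.6 (kurims p. 57).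
* `SurfaceGroupFiniteIndexSubgroup` — a subgroup of finite index `j` in `S_g` (`g ≥ 2`) is itself an
  orientable surface group, of genus `h = j · (g - 1) + 1` (Riemann–Hurwitz; Zieschang–Vogt–
  Coldewey, *Surfaces and Planar Discontinuous Groups*, LNM 835 (1980), Thm 4.14.22 / Prop 4.14.23
  via the Reidemeister–Schreier method of Thm 4.14.1, and §4.10; classically: covering-space theory and
  the Euler characteristic `2 - 2h = j · (2 - 2g)`).
* `two_le_genus_of_index` — the genus produced by the second fact is again `≥ 2`.  Together the two
  facts give HEREDITARY conjugacy separability of orientable surface groups (every finite-index subgroup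
  of `S_g`, `g ≥ 2`, is conjugacy separable) — the form in which [IUTchI] Theorem 2.6's proof uses
  [Stb2] on the finite-index subgroups `G₁ ⊆ G` produced by Lemma 2.7 (ii)/(iii) (kurims p. 57); that
  two-line deduction (transport of conjugacy separability along `K ≃* S_h`, already in the tree as
  `Literature.IUT.HodgeTheaters.ProfiniteCompletion.conjSeparable_of_mulEquiv`) is made by the consumer.

Conjugacy separability is written in the finite-quotient form
`¬ IsConj u v → ∃ L ⊴ G of finite index, ¬ IsConj (u·L) (v·L)` used by the tree's free-group theorem
`FreeGroup.conjugacySeparable` (Stebe 1970 / Lyndon–Schupp I.4.8, PROVED in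
`FreeGroupConjugacySeparable.lean`); no new notion is introduced.  Deliberately NOT here: Fuchsian groups
with torsion (the rest of Stebe's Theorem), non-orientable surface groups, LERF (Scott 1978).
-/

namespace Literature.GroupTheory.CombinatorialGroupTheory

open Literature.Topology.FourManifolds

/-- **Stebe's theorem (orientable surface groups are conjugacy separable)**, as a named fact: for every
`g ≥ 2` and all `u, v ∈ S_g = ⟨a₁, b₁, …, a_g, b_g ∣ ∏ [aᵢ, bᵢ]⟩` that are NOT conjugate in `S_g`, there
is a normal subgroup `L ⊴ S_g` of finite index such that the images of `u` and `v` in the finite group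
`S_g ⧸ L` are not conjugate.  P. F. Stebe, Trans. AMS 163 (1972), Theorem 3.3, p. 182.  A `Prop`-valued
definition: NOT proved here. [cite: Stebe1972, Thm 3.3 p.182] -/
def SurfaceGroupConjugacySeparable : Prop :=
  ∀ g : ℕ, 2 ≤ g → ∀ u v : SurfaceGroup g, ¬ IsConj u v →
    ∃ (L : Subgroup (SurfaceGroup g)) (_ : L.Normal) (_ : L.FiniteIndex),
      ¬ IsConj (QuotientGroup.mk u : SurfaceGroup g ⧸ L) (QuotientGroup.mk v)

/-- **Finite-index subgroups of orientable surface groups are orientable surface groups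
(Riemann–Hurwitz)**, as a named fact: for `g ≥ 2`, a subgroup `K ⊆ S_g` of finite index `j = [S_g : K]`
is isomorphic to the surface group `S_h` of genus `h = j · (g - 1) + 1` (i.e. `h - 1 = j · (g - 1)`,
equivalently `4h - 4 = j · (4g - 4)`, the measure form `μ(K) = [S_g : K] · μ(S_g)`; written without
subtraction on `h`).  Zieschang–Vogt–Coldewey,
LNM 835 (1980), Thm 4.14.22 and Prop 4.14.23 (Reidemeister–Schreier rewriting of a planar presentation,
Thm 4.14.1; surface subgroups §4.10).  A `Prop`-valued definition: NOT proved here.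
[cite: ZieschangVogtColdewey1980, Thm 4.14.22 / Prop 4.14.23 p.154] -/
def SurfaceGroupFiniteIndexSubgroup : Prop :=
  ∀ g : ℕ, 2 ≤ g → ∀ K : Subgroup (SurfaceGroup g), K.FiniteIndex →
    ∃ h : ℕ, h = K.index * (g - 1) + 1 ∧ Nonempty (K ≃* SurfaceGroup h)

/-- The genus supplied by `SurfaceGroupFiniteIndexSubgroup` is again `≥ 2` (`j (g - 1) + 1 ≥ 2`).
[cite: ZieschangVogtColdewey1980, Prop 4.14.23 p.154] -/
theorem two_le_genus_of_index {g h j : ℕ} (hg : 2 ≤ g) (hj : j ≠ 0) (hh : h = j * (g - 1) + 1) :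
    2 ≤ h := by
  have h1 : 1 ≤ j * (g - 1) := Nat.one_le_iff_ne_zero.mpr (Nat.mul_ne_zero hj (by omega))
  omega

end Literature.GroupTheory.CombinatorialGroupTheory
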